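import Summits.BirchSwinnertonDyer.Rank1Residual.F1Sign2.RhombicSymbolCongruenceHolds
import Literature.NumberTheory.EllipticCurves.CuspFormTwistRatPlusSymbolOdd
import Literature.NumberTheory.EllipticCurves.PAdicLFunctionQuadraticTwistBirchPeriodProofs
import Literature.NumberTheory.EllipticCurves.PAdicLFunctionTameMultCongruenceAtTwoProofs
import HarnessLib

/-!
# Route `AlignedTransportAtTwo`, crux C1 `MainConjectureTransportAlignedAtTwo` (stmt-BirchSwinnertonDyer-22296), line `birth` — NEGATIVE
# twists, symbol level: the EXTENDED rhombic plus/minus congruence `[q]⁺_f − [q]⁻_f − [0]⁺_f ∈ ℤ` at every cusp `q` of denominator prime to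
# `N`, Birch's lemma for an ODD quadratic twist `f_A = f_W ⊗ χ_d` (`d < 0`) WITH its period constant, and their combination: the plus symbols
# of `f_A` are `c` times the `χ_d`-twisted PLUS sums of `f_W` UP TO INTEGERS (`[x]⁺_{f_A} = c·(Σ_b χ_d(b)[x + b/|d|]⁺_{f_W} + k)`, `k ∈ ℤ`)

HONEST FRAMING (cell `bsd-f1-sign2`, lead seat `bsd-line-att-p1` g7). BSD is NOT proved; C1 is NOT closed. THEOREMS ONLY; nothing asserted;
`--supports stmt-BirchSwinnertonDyer-22296 --as helper`. The g5/g6 files `…TwistKida*.lean` close C1 on POSITIVE square-free twist pairs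
`W₂ ≅ W₁^{(d)}`, `d > 0`, from the four PRINT facts: Birch's lemma there twists PLUS symbols of `f_W` by the EVEN character `χ_d`. For `d < 0`
the character is ODD and Birch's lemma reads the plus symbol of `f_A` on the MINUS symbols of `f_W` (tree:
`exists_rat_forall_ratPlusSymbol_charTwist_eq_of_odd`), so the tame minus Mazur–Swinnerton-Dyer pipeline would be needed — it is not in the tree.
THIS FILE's observation (the "rhombic shortcut"): when `Λ_{f_W}` is RHOMBIC (`IsRhombic f_W`; at curve level `Δ_W < 0`, which is exactly where
negative-twist pairs of the cell live), the tree's rhombic parity lemma `re_div_sub_im_div_of_rhombic` gives `[q]⁺ − [q]⁻ ≡ [0]⁺ (mod ℤ)` at EVERY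
cusp `q` with denominator prime to `N` (not only at the `2`-power cusps of `RhombicSymbolCongruence`), because `{∞,q} − {∞,0} ∈ Λ_f`
(`modularSymbol_div_sub_zero_mem_periodLattice`); summed against the odd character (`Σ_b χ(b) = 0` kills the constant `[0]⁺`) the minus sums
become plus sums up to integers, and the EVEN-character tame machinery of the tree applies VERBATIM downstream (companion files
`…NegTwistMeasure.lean`, `…NegTwistCongruence.lean`).

* §1 `exists_int_ratPlusSymbol_sub_ratMinusSymbol_eq_of_isRhombic` — `[q]⁺_f − [q]⁻_f = [0]⁺_f + k`, `k ∈ ℤ`, for `q.den` prime to `N`.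
* §2 `gaussSum_stdAddChar_sq_of_isQuadratic_of_odd` (`g(χ)² = −m` for odd primitive quadratic `χ`), `mulChar_jacobi_apply_neg_one_of_three`
  (`χ_d(−1) = −1` for `|d| ≡ 3 (mod 4)`), `exists_ratPlusSymbol_twist_eq_sum_odd_and_sq` — Birch's lemma for `(f_W, f_A)`, `d < 0`:
  `[x]⁺_{f_A} = c · Σ_b χ_d(b)·[x + b/|d|]⁻_{f_W}` and `c²·|d|·(Ω⁺_{f_A})² = (Ω⁻_{f_W})²`.
* §3 `exists_int_ratPlusSymbol_twist_eq_sum_plus_add` — the combination: `[x]⁺_{f_A} = c·(Σ_b χ_d(b)[x + b/|d|]⁺_{f_W} + k)`, `k ∈ ℤ`, for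
  every `x` with `x.den` prime to `N_W`, whenever `Λ_{f_W}` is rhombic.

References: [MazurTateTeitelbaum1986Invent] §I.8; [Shimura1971] Prop. 3.64; [Manin1972] Cor. 3.6; [CremonaAlgorithms1997] §2.8;
[IrelandRosen1990] Prop. 8.2.2; [Pal2012] Thm. 3.2 (the period ratio for `d < 0`).
-/

set_option autoImplicit false
set_option linter.dupNamespace false

noncomputable section

open scoped Classical MatrixGroups ModularForm NumberTheorySymbols

open CongruenceSubgroup WeierstrassCurve NumberField
open Literature.NumberTheory.EllipticCurves Literature.NumberTheory.EllipticCurves.ModularForms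
open Summit.BirchSwinnertonDyer.Rank1Residual.F1Sign2

namespace Summit.BirchSwinnertonDyer.BirchSwinnertonDyer.Theorems.AlignedTransportAtTwoNegTwistSymbol

/-! ## §1 The extended rhombic plus/minus congruence at every cusp of denominator prime to `N` -/

section Rhombic

variable {N : ℕ} [NeZero N] (f : CuspForm (Gamma0 N) 2)

omit [NeZero N] in
/-- The denominator of `q = num/den` is coprime to `num·N` when it is coprime to `N`; private helper. [folklore] -/
private theorem isCoprime_den_num_mul (q : ℚ) (hq : Nat.Coprime q.den N) :
    IsCoprime (q.den : ℤ) (q.num * N) := by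
  refine IsCoprime.mul_right ?_ (Nat.isCoprime_iff_coprime.mpr hq)
  rw [Int.isCoprime_iff_gcd_eq_one, Int.gcd_comm]
  exact q.reduced

/-- **The EXTENDED rhombic symbol congruence.** For a normalised newform `f ∈ S₂(Γ₀(N))` with rational coefficients and RHOMBIC period
lattice (`IsRhombic f`) and every `q ∈ ℚ` whose denominator is prime to `N`: `[q]⁺_f − [q]⁻_f = [0]⁺_f + k` for some `k ∈ ℤ`
(`{∞, q} − {∞, 0} ∈ Λ_f` since the cusp `q` is `Γ₀(N)`-equivalent to `0`, `modularSymbol_div_sub_zero_mem_periodLattice`; every `z ∈ Λ_f` has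
`re z/Ω⁺ − im z/Ω⁻ ∈ ℤ` when `Λ_f` is rhombic, `re_div_sub_im_div_of_rhombic`; `im {∞,0} = 0`). The `2`-power-cusp case with offset `[1/2]⁺`
is the tree's `rhombicSymbolCongruence_holds`. [cite: Manin1972, Cor. 3.6] [cite: CremonaAlgorithms1997, §2.8] [cite: MazurTateTeitelbaum1986Invent, §I.8] -/
theorem exists_int_ratPlusSymbol_sub_ratMinusSymbol_eq_of_isRhombic (hf : IsNewform0 f) (hQ : coeffField f = ⊥)
    (hrh : IsRhombic f) (q : ℚ) (hq : Nat.Coprime q.den N) :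
    ∃ k : ℤ, ratPlusSymbol f q - ratMinusSymbol f q = ratPlusSymbol f 0 + k := by
  have hreal : ∀ n, (cuspCoeff f n).im = 0 := cuspCoeff_im_eq_zero_of_coeffField_eq_bot hQ
  have hden0 : (q.den : ℤ) ≠ 0 := by exact_mod_cast q.den_nz
  have hz := modularSymbol_div_sub_zero_mem_periodLattice f hden0 (isCoprime_den_num_mul q hq)
  have hqq : ((q.num : ℚ) / (q.den : ℤ)) = q := by
    rw [Int.cast_natCast]; exact Rat.num_div_den q
  rw [hqq] at hz
  obtain ⟨hΩp, hre⟩ := plusPeriod_pos_and_realPeriods_eq isZLattice_periodLattice_holds hf hQ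
  have hΩm : 0 < minusPeriod f := IsNewform0.minusPeriod_pos_holds hf hQ
  have him : imagPeriods f = AddSubgroup.zmultiples (minusPeriod f / 2) := by
    rcases minusPeriod_eq_zero_or f with h0 | ⟨_, h⟩
    · exact absurd h0 hΩm.ne'
    · exact h
  have hconj : ∀ z ∈ periodLattice f, (starRingEnd ℂ) z ∈ periodLattice f :=
    fun z hz' ↦ conj_mem_periodLattice_holds hf hQ hz'
  obtain ⟨k, hk⟩ := re_div_sub_im_div_of_rhombic (periodLattice f) hconj hΩp hΩm hre him hrh _ hz
  refine ⟨k, ?_⟩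
  have hPq := ratCast_ratPlusSymbol_holds hf hQ q
  have hP0 := ratCast_ratPlusSymbol_holds hf hQ 0
  have hMq := ratCast_ratMinusSymbol f hf hQ q
  have hM0 := ratCast_ratMinusSymbol f hf hQ 0
  have eP : ∀ r : ℚ, normalizedPlusSymbol f r = (modularSymbol f r).re / plusPeriod f := fun r ↦ by
    rw [normalizedPlusSymbol, plusSymbol_eq_re_holds f hreal, Complex.ofReal_re]
  have eM : ∀ r : ℚ, normalizedMinusSymbol f r = (modularSymbol f r).im / minusPeriod f := fun r ↦ by
    rw [normalizedMinusSymbol, minusSymbol_eq_im_mul_I_holds f hreal, Complex.mul_im, Complex.ofReal_re, Complex.ofReal_im,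
      Complex.I_re, Complex.I_im]
    ring
  have h00 : ratMinusSymbol f 0 = 0 := ratMinusSymbol_zero f
  have hM0' : (modularSymbol f 0).im / minusPeriod f = 0 := by
    rw [← eM, ← hM0, h00, Rat.cast_zero]
  rw [Complex.sub_re, Complex.sub_im, sub_div, sub_div, hM0', sub_zero] at hk
  have key : ((ratPlusSymbol f q : ℚ) : ℝ) - ((ratMinusSymbol f q : ℚ) : ℝ) = ((ratPlusSymbol f 0 : ℚ) : ℝ) + (k : ℝ) := by
    rw [hPq, hP0, hMq, eP, eP, eM]
    linarith
  exact_mod_cast key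

end Rhombic

/-! ## §2 Birch's lemma for an odd quadratic twist of a curve, with the period constant -/

section OddBirch

/-- **`g(χ)² = −m` for an ODD QUADRATIC PRIMITIVE Dirichlet character mod `m`** (any `m ≥ 1`): the Fourier transform of `χ` is `−g(χ)·χ`
(`IsPrimitive.fourierTransform_eq_inv_mul_gaussSum`, `χ⁻¹ = χ`, `χ(−k) = −χ(k)`), and Fourier inversion `𝓕𝓕χ = m·χ(−·)` (`ZMod.dft_dft`) at `1`
gives `g(χ)² = −m`. Odd twin of the tree's `gaussSum_stdAddChar_sq_of_isQuadratic_of_even`. [cite: IrelandRosen1990, Prop. 8.2.2] -/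
theorem gaussSum_stdAddChar_sq_of_isQuadratic_of_odd {m : ℕ} [NeZero m] {χ : DirichletCharacter ℂ m}
    (hχ : χ.IsPrimitive) (hq : MulChar.IsQuadratic χ) (ho : χ.Odd) :
    gaussSum χ (ZMod.stdAddChar (N := m)) ^ 2 = -(m : ℂ) := by
  have ho' : ∀ k : ZMod m, χ (-k) = -χ k := fun k ↦ by
    rw [← neg_one_mul, map_mul, ho, neg_one_mul]
  have h1 : ZMod.dft (⇑χ) = fun k ↦ -(χ k * gaussSum χ (ZMod.stdAddChar (N := m))) := by
    funext k
    rw [hχ.fourierTransform_eq_inv_mul_gaussSum, hq.inv, ho', neg_mul]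
  have h2 := ZMod.dft_dft (⇑χ)
  rw [h1] at h2
  have h1' : ZMod.dft (fun k ↦ -(χ k * gaussSum χ (ZMod.stdAddChar (N := m)))) =
      fun k ↦ -(-(χ k * gaussSum χ (ZMod.stdAddChar (N := m))) * gaussSum χ (ZMod.stdAddChar (N := m))) := by
    have hneg : (fun k ↦ -(χ k * gaussSum χ (ZMod.stdAddChar (N := m)))) =
        -(fun k ↦ χ k * gaussSum χ (ZMod.stdAddChar (N := m))) := rfl
    rw [hneg, map_neg, ZMod.dft_mul_const, h1]
    funext k
    simp only [Pi.neg_apply]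
  rw [h1'] at h2
  have h3 := congrFun h2 1
  simp only [ho', map_one, smul_eq_mul, mul_neg, mul_one, neg_mul, neg_neg, one_mul] at h3
  rw [sq]
  linear_combination h3

variable {m : ℕ} [NeZero m] {χ : MulChar (ZMod m) ℤ} (hχ : ∀ a : ZMod m, χ a = J((a.val : ℤ) | m))
include hχ

/-- Oddness for `m ≡ 3 (mod 4)`: `χ(−1) = (−1 / m) = −1` (`jacobiSym.at_neg_one`, `χ₄(3 mod 4) = −1`). [cite: IrelandRosen1990, Prop. 5.2.2] -/
theorem mulChar_jacobi_apply_neg_one_of_three (hm4 : m % 4 = 3) : χ (-1) = -1 := by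
  have h := mulChar_jacobi_apply_intCast hχ (-1)
  rw [Int.cast_neg, Int.cast_one] at h
  rw [h, jacobiSym.at_neg_one (Nat.odd_iff.mpr (by omega)), ZMod.χ₄_nat_three_mod_four hm4]

omit [NeZero m] hχ in
/-- An odd `ℚ`-valued character is not trivial; private helper. [folklore] -/
private theorem ringHomComp_ne_one_of_neg_one (h : χ (-1) = -1) : χ.ringHomComp (Int.castRingHom ℚ) ≠ 1 := by
  intro h1
  have h2 : (χ.ringHomComp (Int.castRingHom ℚ)) (-1) = 1 := by
    rw [h1]
    exact MulChar.one_apply_coe (-1)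
  rw [MulChar.ringHomComp_apply, h, map_neg, map_one] at h2
  norm_num at h2

end OddBirch

section OddBirchCurve

variable (W : WeierstrassCurve ℚ) [W.IsElliptic] {d : ℤ} {A : WeierstrassCurve ℚ} [A.IsElliptic]
  [NeZero (W.conductorNorm ℤ)] [NeZero (A.conductorNorm ℤ)] [NeZero d.natAbs]
  {fW : CuspForm (Gamma0 (W.conductorNorm ℤ)) 2} {fA : CuspForm (Gamma0 (A.conductorNorm ℤ)) 2}

/-- **Birch's lemma for `(f_W, f_A)`, NEGATIVE `d`, WITH the period constant.** For `d < 0`, `d ≡ 1 (mod 4)` square-free, `(d, N_E) = 1`, `A`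
a model of `E^{(d)}` and the newforms `f_W`, `f_A`: there is ONE `c ∈ ℚ` with `[x]⁺_{f_A} = c · Σ_{b mod |d|} χ_d(b) · [x + b/|d|]⁻_{f_W}` for every
`x` (MINUS symbols of `f_W`: `χ_d = (· / |d|)` is ODD), and, as soon as some `[x]⁺_{f_A} ≠ 0`, `c² · |d| · (Ω⁺_{f_A})² = (Ω⁻_{f_W})²` — the tree's
`exists_rat_forall_ratPlusSymbol_charTwist_eq_of_odd` (`c·Ω⁺_{f_χ}·g(χ) = iΩ⁻_f`) transported along `f_A = charTwist N_A f_W`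
(`isNewformOf_twist_eq_charTwist`, sign-free) and squared with `g(χ_d)² = −|d|`. Odd twin of `exists_ratPlusSymbol_twist_eq_sum_and_sq`.
[cite: MazurTateTeitelbaum1986Invent, §I.8] [cite: Shimura1971, Prop. 3.64] [cite: Pal2012, Thm. 3.2 (the ratio Ω⁻_f/(√|d|·Ω⁺_{f_χ}))] -/
theorem exists_ratPlusSymbol_twist_eq_sum_odd_and_sq (hmod : exists_isNewformOf) (hd : d < 0) (hd4 : d % 4 = 1)
    (hsq : Squarefree d) (hcop : IsCoprime d (W.conductorNorm ℤ : ℤ)) {C : VariableChange ℚ}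
    (hA : C • W.quadraticTwist (d : ℚ) = A) (hfW : IsNewformOf W fW) (hfA : IsNewformOf A fA)
    {χ : MulChar (ZMod d.natAbs) ℤ} (hχ : ∀ a : ZMod d.natAbs, χ a = J((a.val : ℤ) | d.natAbs)) :
    ∃ c : ℚ, (∀ x : ℚ, ratPlusSymbol fA x =
        c * ∑ b : ZMod d.natAbs, (χ.ringHomComp (Int.castRingHom ℚ)) b * ratMinusSymbol fW (x + (b.val : ℚ) / d.natAbs)) ∧
      ((∃ x : ℚ, ratPlusSymbol fA x ≠ 0) → (c : ℝ) ^ 2 * (d.natAbs : ℝ) * plusPeriod fA ^ 2 = minusPeriod fW ^ 2) := by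
  have hodd : Odd d.natAbs := Int.natAbs_odd.mpr (Int.odd_iff.mpr (by omega))
  have hsq' : Squarefree d.natAbs := Int.squarefree_natAbs.mpr hsq
  have hm4 : d.natAbs % 4 = 3 := by omega
  obtain ⟨hq, hprim⟩ := mulChar_jacobi_complex_isQuadratic_isPrimitive hχ hodd hsq'
  have hoddχ : DirichletCharacter.Odd (χ.ringHomComp (Int.castRingHom ℂ)) := by
    show (χ.ringHomComp (Int.castRingHom ℂ)) (-1) = -1
    rw [MulChar.ringHomComp_apply, mulChar_jacobi_apply_neg_one_of_three hχ hm4, map_neg, map_one]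
  have hg2 := gaussSum_stdAddChar_sq_of_isQuadratic_of_odd hprim hq hoddχ
  have hNA := conductorNorm_twist_eq W hmod hd4 hsq hcop hA
  have hN : W.conductorNorm ℤ ∣ A.conductorNorm ℤ := ⟨d.natAbs ^ 2, hNA⟩
  have hm : d.natAbs ^ 2 ∣ A.conductorNorm ℤ := ⟨W.conductorNorm ℤ, by rw [hNA, mul_comm]⟩
  have hFA := isNewformOf_twist_eq_charTwist W hd4 hsq hcop hA hfW hfA hχ hq hprim hN hm
  subst hFA
  obtain ⟨c, hc, hper⟩ := exists_rat_forall_ratPlusSymbol_charTwist_eq_of_odd (A.conductorNorm ℤ) hN hm hq hoddχ hprim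
    hfW.1 hfW.coeffField_eq_bot hfA.1 hfA.coeffField_eq_bot (fun u ↦ J((u.val : ℤ) | d.natAbs))
    (fun u ↦ by rw [MulChar.ringHomComp_apply, hχ, eq_intCast])
  have hsum : ∀ x : ℚ, ∑ b : ZMod d.natAbs, (χ.ringHomComp (Int.castRingHom ℚ)) b *
      ratMinusSymbol fW (x + (b.val : ℚ) / d.natAbs) =
      ∑ u : ZMod d.natAbs, (J((u.val : ℤ) | d.natAbs) : ℚ) * ratMinusSymbol fW (x + twistShift u) := by
    intro x
    refine Finset.sum_congr rfl fun b _ ↦ ?_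
    rw [MulChar.ringHomComp_apply, hχ, eq_intCast]
    rfl
  refine ⟨c, fun x ↦ by rw [hc x, hsum x], fun ⟨x, hx⟩ ↦ ?_⟩
  have hS : ∃ r : ℚ, ∑ u : ZMod d.natAbs, (J((u.val : ℤ) | d.natAbs) : ℚ) * ratMinusSymbol fW (r + twistShift u) ≠ 0 := by
    refine ⟨x, fun h0 ↦ hx ?_⟩
    rw [hc x, h0, mul_zero]
  have hP := hper hS
  -- square and use `g² = −|d|`, `I² = −1`
  have hsqP := congrArg (fun z : ℂ ↦ z ^ 2) hP
  simp only [mul_pow, hg2, Complex.I_sq] at hsqP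
  apply Complex.ofReal_injective
  push_cast
  linear_combination -hsqP

end OddBirchCurve

/-! ## §3 The combination: plus symbols of `f_A` are `c` times twisted PLUS sums of `f_W`, up to integers -/

section Combination

variable {N N' : ℕ} [NeZero N] [NeZero N'] (f : CuspForm (Gamma0 N) 2) (g : CuspForm (Gamma0 N') 2)
  {m : ℕ} [NeZero m]

omit [NeZero N] [NeZero m] in
/-- `(x + b/m).den` is prime to `N` when `x.den` and `m` are; private helper. [folklore] -/
private theorem coprime_den_add_div (hmN : m.Coprime N) {x : ℚ} (hx : Nat.Coprime x.den N) (b : ℕ) :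
    Nat.Coprime (x + (b : ℚ) / m).den N := by
  have h1 : (x + (b : ℚ) / m).den ∣ x.den * ((b : ℚ) / m).den := Rat.add_den_dvd x _
  have h2 : ((b : ℚ) / m).den ∣ m := by
    have h := Rat.den_dvd (b : ℤ) (m : ℤ)
    rw [Rat.divInt_eq_div, Int.cast_natCast, Int.cast_natCast] at h
    exact Int.natCast_dvd_natCast.mp h
  exact Nat.Coprime.coprime_dvd_left h1 (Nat.Coprime.mul_left hx (Nat.Coprime.coprime_dvd_left h2 hmN))

omit [NeZero N'] in
/-- **The rhombic shortcut, symbol level.** Let `f ∈ S₂(Γ₀(N))` be a rational newform with RHOMBIC period lattice, `(m, N) = 1`, `χ` an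
integer-valued character mod `m` with `χ(−1) = −1`, `c ∈ ℚ`, and `g` any weight-`2` form whose plus symbols satisfy the ODD Birch relation
`[x]⁺_g = c · Σ_{b mod m} χ(b) · [x + b/m]⁻_f` for all `x`. Then for every `x ∈ ℚ` with `x.den` prime to `N` there is `k ∈ ℤ` with
`[x]⁺_g = c · (Σ_{b mod m} χ(b) · [x + b/m]⁺_f + k)` — the same relation on the PLUS symbols of `f`, up to an integer: each `[x + b/m]⁻_f` is
`[x + b/m]⁺_f − [0]⁺_f − k_b` (§1; the cusp `x + b/m` has denominator prime to `N`), and `Σ_b χ(b)·[0]⁺_f = 0` (`χ ≠ 1`).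
[cite: MazurTateTeitelbaum1986Invent, §I.8] [cite: Manin1972, Cor. 3.6] -/
theorem exists_int_ratPlusSymbol_twist_eq_sum_plus_add (hf : IsNewform0 f) (hQ : coeffField f = ⊥) (hrh : IsRhombic f)
    (hmN : m.Coprime N) (χ : MulChar (ZMod m) ℤ) (hodd : χ (-1) = -1) {c : ℚ}
    (hB : ∀ x : ℚ, ratPlusSymbol g x =
      c * ∑ b : ZMod m, (χ.ringHomComp (Int.castRingHom ℚ)) b * ratMinusSymbol f (x + (b.val : ℚ) / m))
    (x : ℚ) (hx : Nat.Coprime x.den N) :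
    ∃ k : ℤ, ratPlusSymbol g x =
      c * (∑ b : ZMod m, (χ.ringHomComp (Int.castRingHom ℚ)) b * ratPlusSymbol f (x + (b.val : ℚ) / m) + k) := by
  -- per residue: `[x + b/m]⁻ = [x + b/m]⁺ − [0]⁺ − k_b`
  have hkb : ∀ b : ZMod m, ∃ kb : ℤ, ratMinusSymbol f (x + (b.val : ℚ) / m) =
      ratPlusSymbol f (x + (b.val : ℚ) / m) - ratPlusSymbol f 0 - kb := by
    intro b
    obtain ⟨kb, hkb⟩ := exists_int_ratPlusSymbol_sub_ratMinusSymbol_eq_of_isRhombic f hf hQ hrh _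
      (coprime_den_add_div hmN hx b.val)
    exact ⟨kb, by linear_combination -hkb⟩
  choose kb hkb using hkb
  have hχ1 : χ.ringHomComp (Int.castRingHom ℚ) ≠ 1 := ringHomComp_ne_one_of_neg_one hodd
  have hsum0 : ∑ b : ZMod m, (χ.ringHomComp (Int.castRingHom ℚ)) b = 0 := MulChar.sum_eq_zero_of_ne_one hχ1
  refine ⟨-∑ b : ZMod m, χ b * kb b, ?_⟩
  rw [hB x]
  congr 1
  have hterm : ∀ b : ZMod m, (χ.ringHomComp (Int.castRingHom ℚ)) b * ratMinusSymbol f (x + (b.val : ℚ) / m) =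
      (χ.ringHomComp (Int.castRingHom ℚ)) b * ratPlusSymbol f (x + (b.val : ℚ) / m) -
        (χ.ringHomComp (Int.castRingHom ℚ)) b * ratPlusSymbol f 0 - ((χ b * kb b : ℤ) : ℚ) := by
    intro b
    rw [hkb b, MulChar.ringHomComp_apply, eq_intCast]
    push_cast
    ring
  rw [Finset.sum_congr rfl fun b _ ↦ hterm b, Finset.sum_sub_distrib, Finset.sum_sub_distrib, ← Finset.sum_mul, hsum0, zero_mul,
    sub_zero]
  push_cast
  ring

end Combination

end Summit.BirchSwinnertonDyer.BirchSwinnertonDyer.Theorems.AlignedTransportAtTwoNegTwistSymbol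

end
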